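import Summits.QuantumFields.YangMills.Theorems.PoincareLipschitzBlowDownCells
import Summits.QuantumFields.YangMills.Theorems.PoincareLipschitzSamplingCells
import HarnessLib

/-!
# LINE 25 «CompactnessTransfer» (K2 crux `BlockLipschitzL` stmt-QuantumFields-23533 ∕ crux of record `HistoryTailL` stmt-QuantumFields-19936), S2♭″ (Γ-KNIT) —
# FILE (M) «CELL COUNTS»: the dictionary between integrals of piecewise-constant blow-downs `x ↦ g(z + ⌊R·x⌋)` over cubes and lattice sums over boxes, in the
# three forms the knit consumes — (i) the floor image of the cube `Q_t` lies in `Q_{⌈tR⌉}(0)`, (ii) UPPER count of the rescaled forward differences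
# `∫_{Q_t} ‖R•δ_μ u(z + ⌊Rx⌋)‖² ≤ R⁻¹·Σ_{Q_{⌈tR⌉}(z)} ‖δ_μ u‖²` (so `≤ Λ₀` on `Q`) and their `MemLp 2`, (iii) LOWER count `R⁻³·Σ_{y ∈ S} g y ≤ ∫_A g(z + ⌊Rx⌋)` when the
# cells of `S − z` lie in `A`, whence the `L²`-MISMATCH ROW `R⁻³·Σ_S ‖u y − v(y − z)‖² ≤ 2(∫_A ‖u(z+⌊Rx⌋) − U‖² + ∫_A ‖v(⌊Rx⌋) − V‖²)` when `U = V` on `A`,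
# and (iv) where the cell of a shell point sits (`Q_{(r₂+1)∕R} ∩ {∃ i, r₁∕R ≤ |xᵢ|}`).

Cell `ym3-torus` (YM ladder rung R3 = continuum SU(2) Yang–Mills on T³ — a RUNG, NOT the Clay problem: not d = 4, not infinite volume, not a mass gap);
width seat `ym3-torus-px3` gen 8 (the Γ-KNIT pen, LEAD ★w1-19936 g10 12:29:32Z S2♭″ ARCHITECTURE v0).  THEOREMS ONLY (0 `def`, 0 `sorry`, default heartbeats);
`--supports stmt-QuantumFields-23533 --as helper`.  Letters over ✓`PoincareLipschitzBlowDownCells` (px3 g7 (B): cells `{⌊R x⌋ = y}`, volume `R⁻³`,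
★`setIntegral_comp_floorVec_le_sum`) and ✓`PoincareLipschitzSamplingCells` (w7 g13: `isOpen_absCube`, `volume_real_absCube`).
HONEST SCOPE.  Letters for the knit; S2♭″, S1″, `hHalvingBand`, K1, `MeanDeviationL`, `BlockLipschitzL`, `HistoryTailL` are NOT proved here; YM gap NOT proved.

References: R. Alicandro, M. Cicalese, SIAM J. Math. Anal. 2008, §2 (piecewise-constant interpolation of lattice spin fields) [AlicandroCicalese2008];
S. Luckhaus, Indiana Univ. Math. J. 37 (1988) 349–367 [Luckhaus1988].
-/

set_option autoImplicit false

noncomputable section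

open scoped BigOperators ENNReal
open MeasureTheory Set Finset Filter Topology

namespace Summit.QuantumFields.YangMills.Theorems.PoincareLipschitzLatticeToContinuumCellLetters

open Literature.MathematicalPhysics.QuantumFieldTheory.Balaban1983to89
open B4Eq19LatticeOperators (Zd box unitVec mem_box sum_box_add_right)
open Summit.QuantumFields.YangMills.Theorems.PoincareLipschitzBlowDownCells
open Summit.QuantumFields.YangMills.Theorems.PoincareLipschitzSamplingCells (isOpen_absCube volume_real_absCube)

/-! ## §1 The floor image of a cube -/

/-- For `R > 0` and `|xᵢ| < t` (all `i`): the floor vector `⌊R·x⌋` lies in the lattice cube `Q_{⌈tR⌉}(0)`. [folklore] -/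
theorem floorVec_mem_box {R t : ℝ} (hR : 0 < R) {x : EuclideanSpace ℝ (Fin 3)} (hx : ∀ i : Fin 3, |x i| < t) :
    (fun i => ⌊R * x i⌋ : Zd 3) ∈ box (0 : Zd 3) ⌈t * R⌉ := by
  rw [mem_box]
  intro i
  simp only [Pi.zero_apply, sub_zero]
  have h1 := abs_lt.1 (hx i)
  rw [abs_le]
  constructor
  · have hlt : -(t * R) - 1 < (⌊R * x i⌋ : ℝ) := by
      have := Int.lt_floor_add_one (R * x i)
      nlinarith [h1.1]
    have hle : -((⌈t * R⌉ : ℤ) : ℝ) - 1 ≤ -(t * R) - 1 := by linarith [Int.le_ceil (t * R)]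
    have : -⌈t * R⌉ - 1 < ⌊R * x i⌋ := by exact_mod_cast (hle.trans_lt hlt)
    omega
  · have hle : (⌊R * x i⌋ : ℝ) ≤ t * R := by
      have := Int.floor_le (R * x i)
      nlinarith [h1.2]
    exact_mod_cast hle.trans (Int.le_ceil _)

/-- Centred form: `z + ⌊R·x⌋ ∈ Q_{⌈tR⌉}(z)` for `|xᵢ| < t`. [folklore] -/
theorem add_floorVec_mem_box {R t : ℝ} (hR : 0 < R) (z : Zd 3) {x : EuclideanSpace ℝ (Fin 3)} (hx : ∀ i : Fin 3, |x i| < t) :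
    (z + fun i => ⌊R * x i⌋ : Zd 3) ∈ box z ⌈t * R⌉ := by
  have h := floorVec_mem_box hR hx
  rw [mem_box] at h ⊢
  intro i
  simpa using h i

/-- On the unit cube and for an INTEGER scale `R > 0` the radius is `R` itself: `⌈1·R⌉ = R`. [folklore] -/
theorem ceil_one_mul_intCast (R : ℤ) : ⌈(1 : ℝ) * (R : ℝ)⌉ = R := by
  rw [one_mul, Int.ceil_intCast]

/-! ## §2 Upper count: the rescaled forward differences -/

/-- The open cube `Q_t` has finite volume. [folklore] -/
theorem volume_absCube_lt_top (t : ℝ) : volume {x : EuclideanSpace ℝ (Fin 3) | ∀ i : Fin 3, |x i| < t} < ∞ := by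
  rcases le_or_gt t 0 with ht | ht
  · have : {x : EuclideanSpace ℝ (Fin 3) | ∀ i : Fin 3, |x i| < t} = ∅ := by
      ext x
      simp only [Set.mem_setOf_eq, Set.mem_empty_iff_false, iff_false, not_forall, not_lt]
      exact ⟨0, ht.trans (abs_nonneg _)⟩
    rw [this, measure_empty]; exact ENNReal.zero_lt_top
  · have h8 : (volume {x : EuclideanSpace ℝ (Fin 3) | ∀ i : Fin 3, |x i| < t}).toReal = 8 * t ^ 3 := volume_real_absCube ht.le
    by_contra htop
    rw [not_lt, top_le_iff] at htop
    rw [htop, ENNReal.toReal_top] at h8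
    have : (0:ℝ) < 8 * t ^ 3 := by positivity
    linarith

/-- ★ **UPPER COUNT.**  For `R > 0`, `t > 0`, any lattice map `u`, centre `z` and direction `μ`:
`∫_{Q_t} ‖R•(u(z + ⌊Rx⌋ + e_μ) − u(z + ⌊Rx⌋))‖² ≤ R⁻¹ · Σ_{y ∈ Q_{⌈tR⌉}(z)} ‖u(y + e_μ) − u y‖²`. [cite: AlicandroCicalese2008, §2] -/
theorem setIntegral_normSq_diffQuot_le (u : Zd 3 → EuclideanSpace ℝ (Fin 4)) (z : Zd 3) {R : ℝ} (t : ℝ) (hR : 0 < R) (μ : Fin 3) :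
    ∫ x in {x : EuclideanSpace ℝ (Fin 3) | ∀ i : Fin 3, |x i| < t},
        ‖R • (u ((z + fun i => ⌊R * x i⌋) + unitVec μ) - u (z + fun i => ⌊R * x i⌋))‖ ^ 2
      ≤ R⁻¹ * ∑ y ∈ box z ⌈t * R⌉, ‖u (y + unitVec μ) - u y‖ ^ 2 := by
  have h := setIntegral_comp_floorVec_le_sum hR (isOpen_absCube t).measurableSet (box (0 : Zd 3) ⌈t * R⌉)
    (fun x hx => floorVec_mem_box hR hx) (fun y => ‖R • (u ((z + y) + unitVec μ) - u (z + y))‖ ^ 2) (fun y => by positivity)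
  refine h.trans (le_of_eq ?_)
  have hsum : ∑ y ∈ box (0 : Zd 3) ⌈t * R⌉, ‖R • (u ((z + y) + unitVec μ) - u (z + y))‖ ^ 2
      = R ^ 2 * ∑ y ∈ box z ⌈t * R⌉, ‖u (y + unitVec μ) - u y‖ ^ 2 := by
    have := sum_box_add_right (fun y => ‖u (y + unitVec μ) - u y‖ ^ 2) (0 : Zd 3) z ⌈t * R⌉
    rw [zero_add] at this
    rw [← this, Finset.mul_sum]
    refine Finset.sum_congr rfl fun y _ => ?_
    rw [norm_smul, mul_pow, Real.norm_eq_abs, sq_abs, add_comm z y]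
  rw [hsum]
  have hR0 : R ≠ 0 := hR.ne'
  field_simp

/-- The same summed over the three directions: `∫_{Q_t} Σ_μ ‖R•δ_μ u(z+⌊Rx⌋)‖² ≤ R⁻¹·E_u(Q_{⌈tR⌉}(z))`. [cite: AlicandroCicalese2008, §2] -/
theorem setIntegral_sum_normSq_diffQuot_le (u : Zd 3 → EuclideanSpace ℝ (Fin 4)) (hu : ∀ y, ‖u y‖ = 1) (z : Zd 3) {R : ℝ} (t : ℝ) (hR : 0 < R) :
    ∫ x in {x : EuclideanSpace ℝ (Fin 3) | ∀ i : Fin 3, |x i| < t},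
        ∑ μ : Fin 3, ‖R • (u ((z + fun i => ⌊R * x i⌋) + unitVec μ) - u (z + fun i => ⌊R * x i⌋))‖ ^ 2
      ≤ R⁻¹ * ∑ y ∈ box z ⌈t * R⌉, ∑ μ : Fin 3, ‖u (y + unitVec μ) - u y‖ ^ 2 := by
  rw [integral_finsetSum]
  · rw [Finset.sum_comm, Finset.mul_sum]
    exact Finset.sum_le_sum fun μ _ => setIntegral_normSq_diffQuot_le u z t hR μ
  · intro μ _
    have hb : ∀ y : Zd 3, ‖(fun y : Zd 3 => ‖R • (u ((z + y) + unitVec μ) - u (z + y))‖ ^ 2) y‖ ≤ (R * 2) ^ 2 := by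
      intro y
      dsimp only
      rw [Real.norm_eq_abs, abs_of_nonneg (by positivity), norm_smul, mul_pow, Real.norm_eq_abs, abs_of_pos hR, mul_pow]
      have h2 : ‖u ((z + y) + unitVec μ) - u (z + y)‖ ≤ 2 :=
        calc ‖u ((z + y) + unitVec μ) - u (z + y)‖ ≤ ‖u ((z + y) + unitVec μ)‖ + ‖u (z + y)‖ := norm_sub_le _ _
          _ = 2 := by rw [hu, hu]; norm_num
      exact mul_le_mul_of_nonneg_left (pow_le_pow_left₀ (norm_nonneg _) h2 2) (sq_nonneg R)
    exact integrableOn_comp_floorVec_of_bound _ R hb (volume_absCube_lt_top t)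

/-- The rescaled forward difference of a unit lattice map is in `L²` of every cube `Q_t`. [folklore] -/
theorem memLp_diffQuot (u : Zd 3 → EuclideanSpace ℝ (Fin 4)) (hu : ∀ y, ‖u y‖ = 1) (z : Zd 3) (R : ℝ) (t : ℝ) (μ : Fin 3) :
    MemLp (fun x : EuclideanSpace ℝ (Fin 3) => R • (u ((z + fun i => ⌊R * x i⌋) + unitVec μ) - u (z + fun i => ⌊R * x i⌋)))
      2 (volume.restrict {x : EuclideanSpace ℝ (Fin 3) | ∀ i : Fin 3, |x i| < t}) := by
  have hb : ∀ y : Zd 3, ‖(fun y : Zd 3 => R • (u ((z + y) + unitVec μ) - u (z + y))) y‖ ≤ |R| * 2 := by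
    intro y
    dsimp only
    rw [norm_smul, Real.norm_eq_abs]
    gcongr
    calc ‖u ((z + y) + unitVec μ) - u (z + y)‖ ≤ ‖u ((z + y) + unitVec μ)‖ + ‖u (z + y)‖ := norm_sub_le _ _
      _ = 2 := by rw [hu, hu]; norm_num
  exact memLp_comp_floorVec_of_bound _ R hb (volume_absCube_lt_top t) 2

/-- ★ **THE `Λ₀` BOUND ON THE UNIT CUBE** (integer scale `R ≥ 1`): `∫_Q ‖R•δ_μ u(z + ⌊Rx⌋)‖² ≤ R⁻¹·E_u(Q_R(z))`, so `≤ Λ₀` when `E_u(Q_R(z)) ≤ Λ₀ R`.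
[cite: AlicandroCicalese2008, §2] -/
theorem setIntegral_normSq_diffQuot_le_of_energy (u : Zd 3 → EuclideanSpace ℝ (Fin 4)) (z : Zd 3) {R : ℤ} (hR : 0 < R) (μ : Fin 3) {Λ₀ : ℝ}
    (hE : ∑ y ∈ box z R, ∑ μ : Fin 3, ‖u (y + unitVec μ) - u y‖ ^ 2 ≤ Λ₀ * R) :
    ∫ x in {x : EuclideanSpace ℝ (Fin 3) | ∀ i : Fin 3, |x i| < 1},
        ‖(R : ℝ) • (u ((z + fun i => ⌊(R : ℝ) * x i⌋) + unitVec μ) - u (z + fun i => ⌊(R : ℝ) * x i⌋))‖ ^ 2 ≤ Λ₀ := by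
  have hR' : (0 : ℝ) < R := by exact_mod_cast hR
  have h := setIntegral_normSq_diffQuot_le u z 1 hR' μ
  rw [ceil_one_mul_intCast] at h
  refine h.trans ?_
  have hμ : ∑ y ∈ box z R, ‖u (y + unitVec μ) - u y‖ ^ 2 ≤ ∑ y ∈ box z R, ∑ ν : Fin 3, ‖u (y + unitVec ν) - u y‖ ^ 2 :=
    Finset.sum_le_sum fun y _ => Finset.single_le_sum (f := fun ν => ‖u (y + unitVec ν) - u y‖ ^ 2) (fun ν _ => by positivity) (Finset.mem_univ μ)
  calc (R : ℝ)⁻¹ * ∑ y ∈ box z R, ‖u (y + unitVec μ) - u y‖ ^ 2 ≤ (R : ℝ)⁻¹ * (Λ₀ * R) :=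
        mul_le_mul_of_nonneg_left (hμ.trans hE) (inv_nonneg.2 hR'.le)
    _ = Λ₀ := by field_simp

/-! ## §3 Lower count and the `L²`-mismatch row -/

/-- Distinct lattice points have disjoint floor cells. [folklore] -/
theorem disjoint_floorCell (R : ℝ) {y y' : Zd 3} (h : y ≠ y') :
    Disjoint {x : EuclideanSpace ℝ (Fin 3) | ∀ i, ⌊R * x i⌋ = y i} {x : EuclideanSpace ℝ (Fin 3) | ∀ i, ⌊R * x i⌋ = y' i} := by
  rw [Set.disjoint_left]
  intro x hx hx'
  exact h (funext fun i => (hx i).symm.trans (hx' i))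

/-- ★ **LOWER COUNT.**  For `R > 0`, `g ≥ 0`, a finite `S ⊆ ℤ³`, a centre `z` and a measurable `A` containing the cells `{⌊R x⌋ = y − z}`, `y ∈ S`, on which
`x ↦ g(z + ⌊Rx⌋)` is integrable: `R⁻³ · Σ_{y ∈ S} g y ≤ ∫_A g(z + ⌊R x⌋) dx`. [cite: AlicandroCicalese2008, §2] -/
theorem sum_le_setIntegral_comp_floorVec {R : ℝ} (hR : 0 < R) (g : Zd 3 → ℝ) (hg : ∀ y, 0 ≤ g y) (S : Finset (Zd 3)) (z : Zd 3)
    {A : Set (EuclideanSpace ℝ (Fin 3))}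
    (hSA : ∀ y ∈ S, {x : EuclideanSpace ℝ (Fin 3) | ∀ i, ⌊R * x i⌋ = y i - z i} ⊆ A)
    (hint : IntegrableOn (fun x : EuclideanSpace ℝ (Fin 3) => g (z + fun i => ⌊R * x i⌋)) A volume) :
    R⁻¹ ^ 3 * ∑ y ∈ S, g y ≤ ∫ x in A, g (z + fun i => ⌊R * x i⌋) := by
  classical
  -- the union of the cells of `S − z`
  set cell : Zd 3 → Set (EuclideanSpace ℝ (Fin 3)) := fun y => {x | ∀ i, ⌊R * x i⌋ = y i - z i} with hcell
  have hcellm : ∀ y, MeasurableSet (cell y) := fun y => measurableSet_floorCell R (y - z)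
  have hU : (⋃ y ∈ S, cell y) ⊆ A := Set.iUnion₂_subset fun y hy => hSA y hy
  have hdisj : Set.PairwiseDisjoint (↑S : Set (Zd 3)) cell := by
    intro y _ y' _ hne
    have : y - z ≠ y' - z := fun h => hne (sub_left_injective h)
    exact disjoint_floorCell R this
  calc R⁻¹ ^ 3 * ∑ y ∈ S, g y = ∑ y ∈ S, ∫ x in cell y, g (z + fun i => ⌊R * x i⌋) := by
        rw [Finset.mul_sum]
        refine Finset.sum_congr rfl fun y _ => ?_
        have hconst : ∫ x in cell y, g (z + fun i => ⌊R * x i⌋) = ∫ x in cell y, g y := by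
          refine setIntegral_congr_fun (hcellm y) fun x hx => ?_
          congr 1
          funext i
          simp only [Pi.add_apply, hx i, add_sub_cancel]
        rw [hconst, setIntegral_const, smul_eq_mul, measureReal_def]
        have : (volume (cell y)).toReal = R⁻¹ ^ 3 := volume_real_floorCell hR (y - z)
        rw [this, mul_comm]
    _ = ∫ x in ⋃ y ∈ S, cell y, g (z + fun i => ⌊R * x i⌋) := by
        rw [integral_biUnion_finset S (fun y _ => hcellm y) hdisj]
        intro y hy
        exact hint.mono_set ((Set.subset_iUnion₂ (s := fun y' _ => cell y') y hy).trans hU)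
    _ ≤ ∫ x in A, g (z + fun i => ⌊R * x i⌋) :=
        setIntegral_mono_set hint (Eventually.of_forall fun x => hg _) (Eventually.of_forall hU)

/-- ★ **THE `L²`-MISMATCH ROW.**  For `R > 0`, unit-or-not lattice maps `u, v`, a finite `S`, a centre `z`, a measurable `A ⊇` the cells of `S − z` of finite
measure, maps `U, V` with `U = V` on `A`, and the two squared distances integrable on `A`:
`R⁻³ · Σ_{y ∈ S} ‖u y − v (y − z)‖² ≤ 2·(∫_A ‖u(z + ⌊Rx⌋) − U x‖² + ∫_A ‖v(⌊Rx⌋) − V x‖²)`. [cite: Luckhaus1988, Lemma 1 (the `L²` term)] -/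
theorem mismatch_sum_le (u v : Zd 3 → EuclideanSpace ℝ (Fin 4)) {R : ℝ} (hR : 0 < R) (S : Finset (Zd 3)) (z : Zd 3)
    {A : Set (EuclideanSpace ℝ (Fin 3))} (hA : MeasurableSet A) (hAfin : volume A < ∞)
    (hSA : ∀ y ∈ S, {x : EuclideanSpace ℝ (Fin 3) | ∀ i, ⌊R * x i⌋ = y i - z i} ⊆ A)
    (U V : EuclideanSpace ℝ (Fin 3) → EuclideanSpace ℝ (Fin 4)) (hUV : ∀ x ∈ A, U x = V x)
    (hU : IntegrableOn (fun x => ‖u (z + fun i => ⌊R * x i⌋) - U x‖ ^ 2) A volume)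
    (hV : IntegrableOn (fun x => ‖v (fun i => ⌊R * x i⌋) - V x‖ ^ 2) A volume)
    (hb : ∃ B : ℝ, ∀ y, ‖u y - v (y - z)‖ ^ 2 ≤ B) :
    R⁻¹ ^ 3 * ∑ y ∈ S, ‖u y - v (y - z)‖ ^ 2 ≤
      2 * ((∫ x in A, ‖u (z + fun i => ⌊R * x i⌋) - U x‖ ^ 2) + ∫ x in A, ‖v (fun i => ⌊R * x i⌋) - V x‖ ^ 2) := by
  obtain ⟨B, hB⟩ := hb
  have hint : IntegrableOn (fun x : EuclideanSpace ℝ (Fin 3) => (fun y => ‖u y - v (y - z)‖ ^ 2) (z + fun i => ⌊R * x i⌋)) A volume := by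
    have hb' : ∀ y : Zd 3, ‖(fun y : Zd 3 => ‖u (z + y) - v y‖ ^ 2) y‖ ≤ max B 0 := by
      intro y
      rw [Real.norm_eq_abs, abs_of_nonneg (by positivity)]
      have := hB (z + y)
      rw [add_sub_cancel_left] at this
      exact this.trans (le_max_left _ _)
    have h := integrableOn_comp_floorVec_of_bound (fun y : Zd 3 => ‖u (z + y) - v y‖ ^ 2) R hb' hAfin
    refine h.congr_fun (fun x _ => ?_) hA
    simp only [add_sub_cancel_left]
  have h1 := sum_le_setIntegral_comp_floorVec hR (fun y => ‖u y - v (y - z)‖ ^ 2) (fun y => by positivity) S z hSA hint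
  refine h1.trans ?_
  rw [← integral_add hU hV, ← integral_const_mul]
  refine setIntegral_mono_on hint ((hU.add hV).const_mul 2) hA fun x hx => ?_
  -- pointwise: `‖a − b‖² ≤ 2(‖a − U‖² + ‖b − V‖²)` with `U = V`
  have e1 : (z + fun i => ⌊R * x i⌋) - z = (fun i => ⌊R * x i⌋ : Zd 3) := add_sub_cancel_left _ _
  show ‖u (z + fun i => ⌊R * x i⌋) - v ((z + fun i => ⌊R * x i⌋) - z)‖ ^ 2 ≤
    2 * (‖u (z + fun i => ⌊R * x i⌋) - U x‖ ^ 2 + ‖v (fun i => ⌊R * x i⌋) - V x‖ ^ 2)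
  rw [e1, hUV x hx]
  set a := u (z + fun i => ⌊R * x i⌋)
  set b := v (fun i => ⌊R * x i⌋)
  have hab : ‖a - b‖ ≤ ‖a - V x‖ + ‖b - V x‖ := by
    calc ‖a - b‖ = ‖(a - V x) - (b - V x)‖ := by congr 1; abel
      _ ≤ ‖a - V x‖ + ‖b - V x‖ := norm_sub_le _ _
  have h2 : ‖a - b‖ ^ 2 ≤ (‖a - V x‖ + ‖b - V x‖) ^ 2 := pow_le_pow_left₀ (norm_nonneg _) hab 2
  nlinarith [norm_nonneg (a - V x), norm_nonneg (b - V x), h2, sq_nonneg (‖a - V x‖ - ‖b - V x‖)]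

/-! ## §4 Where the cell of a shell point sits -/

/-- The cell `{⌊R x⌋ = y − z}` of a point `y ∈ Q_{r₂}(z) ∖ Q_{r₁}(z)` (`0 ≤ r₁`) lies in the cube `Q_{(r₂+1)∕R}` and off the open cube `Q_{r₁∕R}`: every `x` in it
has `|xᵢ| < (r₂+1)∕R` for all `i` and `r₁∕R ≤ |xᵢ|` for some `i`. [folklore] -/
theorem floorCell_subset_shell {R : ℝ} (hR : 0 < R) {z y : Zd 3} {r₁ r₂ : ℤ} (hr₁ : 0 ≤ r₁) (hy₂ : y ∈ box z r₂) (hy₁ : y ∉ box z r₁) :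
    {x : EuclideanSpace ℝ (Fin 3) | ∀ i, ⌊R * x i⌋ = y i - z i} ⊆
      {x | (∀ i : Fin 3, |x i| < ((r₂ : ℝ) + 1) / R) ∧ ∃ i : Fin 3, (r₁ : ℝ) / R ≤ |x i|} := by
  intro x hx
  have hlo : ∀ i, ((y i - z i : ℤ) : ℝ) ≤ R * x i := fun i => by rw [← hx i]; exact Int.floor_le _
  have hhi : ∀ i, R * x i < ((y i - z i : ℤ) : ℝ) + 1 := fun i => by rw [← hx i]; exact Int.lt_floor_add_one _
  rw [mem_box] at hy₂
  have hr₁' : (0 : ℝ) ≤ r₁ := by exact_mod_cast hr₁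
  constructor
  · intro i
    have h2 := abs_le.1 (hy₂ i)
    have h2a : -(r₂ : ℝ) ≤ ((y i - z i : ℤ) : ℝ) := by exact_mod_cast h2.1
    have h2b : ((y i - z i : ℤ) : ℝ) ≤ r₂ := by exact_mod_cast h2.2
    rw [lt_div_iff₀ hR]
    calc |x i| * R = |R * x i| := by rw [abs_mul, abs_of_pos hR, mul_comm]
      _ < r₂ + 1 := abs_lt.2 ⟨by linarith [hlo i], by linarith [hhi i]⟩
  · rw [mem_box] at hy₁
    push Not at hy₁
    obtain ⟨i, hi⟩ := hy₁
    refine ⟨i, ?_⟩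
    rw [div_le_iff₀ hR]
    rcases le_or_gt 0 (y i - z i) with hpos | hneg
    · rw [abs_of_nonneg hpos] at hi
      have h3 : (r₁ : ℝ) + 1 ≤ ((y i - z i : ℤ) : ℝ) := by exact_mod_cast hi
      have hRx : 0 < R * x i := by linarith [hlo i]
      have hxpos : 0 < x i := pos_of_mul_pos_right hRx hR.le
      rw [abs_of_pos hxpos]
      linarith [hlo i, mul_comm R (x i)]
    · rw [abs_of_neg hneg] at hi
      have h3 : ((y i - z i : ℤ) : ℝ) + 1 ≤ -r₁ := by
        have : y i - z i + 1 ≤ -r₁ := by linarith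
        exact_mod_cast this
      have hRx : R * x i < 0 := by linarith [hhi i]
      have hxneg : x i < 0 := neg_of_mul_neg_right hRx hR.le
      rw [abs_of_neg hxneg]
      linarith [hhi i, mul_comm R (x i)]

end Summit.QuantumFields.YangMills.Theorems.PoincareLipschitzLatticeToContinuumCellLetters

end
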